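import Summits.AnomalousDissipation.AnomalousDissipation.Theorems.SawtoothPulseCascadeK1LocalisedCascadeFibreWindowTwo
import Summits.AnomalousDissipation.AnomalousDissipation.Theorems.SawtoothPulseCascadeK1LocalisedCascadeAxisCutoff
import Summits.AnomalousDissipation.AnomalousDissipation.Theorems.SawtoothPulseCascadeK1LocalisedCascadeSawtoothChirp
import Summits.AnomalousDissipation.AnomalousDissipation.Theorems.SawtoothPulseCascadeK1LocalisedCascadeCornerLayer

/-!
# K1loc, line `Spectral` / thin start — helper: THE V HALF-STEP WINDOW INEQUALITY OF THE FIBRE LEDGER (integer strain)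

Helper file of the prover lane on the crux `K1LocalisedCascade` (stmt-AnomalousDissipation-19491), route
`SawtoothPulseCascade` (S-D fibre ledger: the per-half-step inequality for the ACTUAL cascade, V form `a = b ∘ Φ_V`,
`Φ_V = shearMap 1 0 (γU_j)`, integer `γ`).  Assembly of the landed bricks:
* §1 `sum_window_sq_norm_comp_shearMap_le_fibre` — the window lemma of `…FibreWindow` with the pass-through term restricted to
  the fibres met by the window: `(√(∫ρ(x_j)²‖θ₁‖²) + √(Σ_{n∈F}∫‖A^i_nθ₂‖²))²`, `F = {kᵢ : k ∈ W}`;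
* §2 the exact chirp `g₀^n = e^{−2πi nγ U⁰_j}` as a continuous circle function (periodic lift) and its splitting
  `g_n = (ψ_n ⋆ g₀^n + (g_n − g₀^n)) + (g₀^n − ψ_n ⋆ g₀^n)`: exact separation from the coefficients `(1 − ψ_n(m))ĝ₀^n(m)`
  (`…CircleCutoff`), pointwise bound by `ε` off the corner layer (`…SawtoothChirp`) and by `A` on it, hence by the continuous
  majorant `ρ = ε + 2A·tent_{2w}` (`…CornerLayer`);
* §3 **`sum_window_sq_norm_vstep_le`** — for `b` continuous with summable coefficients and `|b| ≤ 1`, an input cut-off `χ` in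
  `k₀` (`|χ| ≤ 1`, supported in `|l| < L`), per-fibre mid-band symbols `ψ_n` (`ψ_n(±nγ) = 0`, plateau `ψ_n(k₀ − l) = 1` for `k ∈ W`,
  `|l| < L`), a layer width `w` with `Mδ_j < 2πN_jw`, and constants `A ≥ ∫|k_{ψ_n}| + 2`, `ε ≥ 4∫_{‖s‖≥w/2}|k_{ψ_n}| + π|nγ|e^{−M²/2}/N_j`
  on the fibres of `W`:
  `Σ_{k∈W} ‖𝓕(b ∘ Φ_V)(k)‖² ≤ ( (∫|k_χ|)·√(ε² + (ε + 2A)²·(2N_j·4w)) + √(Σ_{n∈F} ∫‖A¹_n(b − T_χ b)‖²) )²`.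
  The first term is the junk of the half-step (kernel `L¹` norm × layer mass, scale-free); the second is the energy of `b` OUTSIDE the
  cut-off `χ` on the fibres of the window — the only input that can legitimately land in the window.
No definitions; no statement about the crux. [cite: Grafakos2014, Prop. 3.1.2 (5) and Prop. 3.2.7 (3)]
[cite: ElgindiLissMattingly2025, §1 (slope ±1 branches)] [problem: turb]
-/

-- `Summit.<Summit>.<Problem>`: single-conjunct summit, the duplicate namespace segment is deliberate.
set_option linter.dupNamespace false

noncomputable section

namespace Summit.AnomalousDissipation.AnomalousDissipation.Theorems.SawtoothPulseCascade.K1Window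

open MeasureTheory Set Filter Topology UnitAddTorus Function Complex Metric
open scoped Real ENNReal
open Literature.Analysis Literature.Analysis.FunctionSpaces Literature.Analysis.FunctionSpaces.Torus Literature.Analysis.FluidPDE
open Literature.Analysis.FluidPDE.ShearStage
open Literature.Analysis.FluidPDE.SawtoothCascade Literature.Analysis.FluidPDE.SawtoothCascade.CascadeParams
open Summit.AnomalousDissipation.AnomalousDissipation.Theorems.SawtoothPulseCascade.K1Start
open Summit.AnomalousDissipation.AnomalousDissipation.Theorems.SawtoothPulseCascade.K1Flat

/-! ## §1 The window lemma with fibre-restricted pass-through term -/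

section Fibre

variable {d : Type*} [Fintype d] [DecidableEq d]

/-- **Window lemma, fibre-restricted form**: as `…FibreWindow.sum_window_sq_norm_comp_shearMap_le`, but the pass-through term
only counts the fibre components of `θ₂` on the fibres met by the window. [cite: Grafakos2014, Prop. 3.1.2 (5) and Prop. 3.2.7 (3)] -/
theorem sum_window_sq_norm_comp_shearMap_le_fibre {θ₁ θ₂ : UnitAddTorus d → ℂ} (hθ₁ : Continuous θ₁)
    (hθ₁s : Summable fun k => ‖mFourierCoeff θ₁ k‖) (hθ₂ : Continuous θ₂) {i j : d} (hij : i ≠ j) (P : ShearProfile)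
    (W : Finset (d → ℤ)) (gmid grest : ℤ → UnitAddCircle → ℂ) (hgmid : ∀ n, Continuous (gmid n))
    (hgrest : ∀ n, Continuous (grest n)) (hsplit : ∀ k ∈ W, ∀ b, twist P (k i) b = gmid (k i) b + grest (k i) b)
    (hsep : ∀ k ∈ W, ∀ m : ℤ, fourierCoeff (grest (k i)) m * mFourierCoeff θ₁ (k - Pi.single j m) = 0)
    {ρ : UnitAddCircle → ℝ} (hρ : Continuous ρ) (hρ0 : ∀ b, 0 ≤ ρ b) (hbd : ∀ k ∈ W, ∀ b, ‖gmid (k i) b‖ ≤ ρ b) :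
    ∑ k ∈ W, ‖mFourierCoeff ((fun x => θ₁ x + θ₂ x) ∘ shearMap i j P) k‖ ^ 2 ≤
      (Real.sqrt (∫ x : UnitAddTorus d, ρ (x j) ^ 2 * ‖θ₁ x‖ ^ 2) +
        Real.sqrt (∑ n ∈ W.image (fun k => k i),
          ∫ x : UnitAddTorus d, ‖∫ s : UnitAddCircle, (fourier (-n) s : ℂ) • θ₂ (x + Pi.single i s)‖ ^ 2)) ^ 2 := by
  classical
  set H₁ : ℤ → UnitAddTorus d → ℂ := fun n x => gmid n (x j) *
    ∫ s : UnitAddCircle, (fourier (-n) s : ℂ) • θ₁ (x + Pi.single i s) with hH₁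
  set H₂ : ℤ → UnitAddTorus d → ℂ := fun n x => twist P n (x j) *
    ∫ s : UnitAddCircle, (fourier (-n) s : ℂ) • θ₂ (x + Pi.single i s) with hH₂
  have hH₂c : ∀ n, Continuous (H₂ n) := fun n =>
    ((continuous_twist P n).comp (continuous_apply j)).mul (continuous_twistedAxisAvg hθ₂ i n)
  have hcoef : ∀ k ∈ W, mFourierCoeff ((fun x => θ₁ x + θ₂ x) ∘ shearMap i j P) k =
      mFourierCoeff (H₁ (k i)) k + mFourierCoeff (H₂ (k i)) k := by
    intro k hk
    have hsum : ((fun x => θ₁ x + θ₂ x) ∘ shearMap i j P) = (θ₁ ∘ shearMap i j P) + (θ₂ ∘ shearMap i j P) := by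
      funext x; rfl
    rw [hsum, Torus.mFourierCoeff_add (F := ℂ) ((hθ₁.comp (continuous_shearMap i j P)).integrable_unitAddTorus)
      ((hθ₂.comp (continuous_shearMap i j P)).integrable_unitAddTorus),
      mFourierCoeff_comp_shearMap_eq_mid hθ₁ hθ₁s hij P (hgmid (k i)) (hgrest (k i)) k (hsplit k hk) (hsep k hk),
      mFourierCoeff_comp_shearMap_eq_chirp hθ₂ hij P k]
  have hM : ∑ k ∈ W, ‖mFourierCoeff ((fun x => θ₁ x + θ₂ x) ∘ shearMap i j P) k‖ ^ 2 ≤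
      (Real.sqrt (∑ k ∈ W, ‖mFourierCoeff (H₁ (k i)) k‖ ^ 2) + Real.sqrt (∑ k ∈ W, ‖mFourierCoeff (H₂ (k i)) k‖ ^ 2)) ^ 2 := by
    have h1 : ∑ k ∈ W, ‖mFourierCoeff ((fun x => θ₁ x + θ₂ x) ∘ shearMap i j P) k‖ ^ 2 ≤
        ∑ k ∈ W, (‖mFourierCoeff (H₁ (k i)) k‖ + ‖mFourierCoeff (H₂ (k i)) k‖) ^ 2 := by
      refine Finset.sum_le_sum fun k hk => ?_
      rw [hcoef k hk]
      exact pow_le_pow_left₀ (norm_nonneg _) (norm_add_le _ _) 2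
    have h2 := SpectralLeakage.sqrt_sum_add_sq_le W (a := fun k => ‖mFourierCoeff (H₁ (k i)) k‖)
      (b := fun k => ‖mFourierCoeff (H₂ (k i)) k‖) (fun k _ => norm_nonneg _) (fun k _ => norm_nonneg _)
    have h0 : 0 ≤ ∑ k ∈ W, (‖mFourierCoeff (H₁ (k i)) k‖ + ‖mFourierCoeff (H₂ (k i)) k‖) ^ 2 :=
      Finset.sum_nonneg fun k _ => sq_nonneg _
    calc ∑ k ∈ W, ‖mFourierCoeff ((fun x => θ₁ x + θ₂ x) ∘ shearMap i j P) k‖ ^ 2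
        ≤ ∑ k ∈ W, (‖mFourierCoeff (H₁ (k i)) k‖ + ‖mFourierCoeff (H₂ (k i)) k‖) ^ 2 := h1
      _ = (Real.sqrt (∑ k ∈ W, (‖mFourierCoeff (H₁ (k i)) k‖ + ‖mFourierCoeff (H₂ (k i)) k‖) ^ 2)) ^ 2 :=
          (Real.sq_sqrt h0).symm
      _ ≤ _ := pow_le_pow_left₀ (Real.sqrt_nonneg _) h2 2
  have hA := sum_sq_norm_mid_le hθ₁ hij W gmid hgmid hρ hρ0 hbd
  have hB : ∑ k ∈ W, ‖mFourierCoeff (H₂ (k i)) k‖ ^ 2 ≤ ∑ n ∈ W.image (fun k => k i),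
      ∫ x : UnitAddTorus d, ‖∫ s : UnitAddCircle, (fourier (-n) s : ℂ) • θ₂ (x + Pi.single i s)‖ ^ 2 := by
    set F : Finset ℤ := W.image fun k => k i with hF
    have hmaps : ∀ k ∈ W, k i ∈ F := fun k hk => Finset.mem_image_of_mem _ hk
    rw [← Finset.sum_fiberwise_of_maps_to hmaps]
    refine Finset.sum_le_sum fun n hn => ?_
    calc ∑ k ∈ W with k i = n, ‖mFourierCoeff (H₂ (k i)) k‖ ^ 2
        = ∑ k ∈ W with k i = n, ‖mFourierCoeff (H₂ n) k‖ ^ 2 :=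
          Finset.sum_congr rfl fun k hk => by rw [(Finset.mem_filter.mp hk).2]
      _ ≤ ∫ x : UnitAddTorus d, ‖H₂ n x‖ ^ 2 := sum_sq_norm_mFourierCoeff_le_integral (hH₂c n) _
      _ = ∫ x : UnitAddTorus d, ‖∫ s : UnitAddCircle, (fourier (-n) s : ℂ) • θ₂ (x + Pi.single i s)‖ ^ 2 :=
          integral_congr_ae (Eventually.of_forall fun x => by simp only [hH₂, norm_mul, norm_twist, one_mul])
  exact hM.trans (pow_le_pow_left₀ (by positivity) (add_le_add (Real.sqrt_le_sqrt hA) (Real.sqrt_le_sqrt hB)) 2)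

end Fibre

/-! ## §2 The exact chirp as a circle function -/

/-- The function `t ↦ exp(−2πiλ·tri(2πNt)/(2πN))` is `1`-periodic. [folklore] -/
theorem periodic_exactChirpFun (N : ℕ) (lam : ℤ) :
    Function.Periodic (fun t : ℝ => Complex.exp (-(2 * π * I * lam * ((tri (2 * π * N * t) / (2 * π * N) : ℝ) : ℂ)))) 1 := by
  intro t
  simp only
  rw [show 2 * π * (N : ℝ) * (t + 1) = 2 * π * N * t + N * (2 * π) by ring, tri_periodic.nat_mul N]

/-- The periodic lift `g₀` of the exact chirp is continuous and takes the value `exp(−2πiλ·tri(2πNt)/(2πN))` at `t`. [folklore] -/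
theorem continuous_exactChirp_lift (N : ℕ) (lam : ℤ) :
    Continuous (periodic_exactChirpFun N lam).lift ∧
      ∀ t : ℝ, (periodic_exactChirpFun N lam).lift (t : UnitAddCircle) =
        Complex.exp (-(2 * π * I * lam * ((tri (2 * π * N * t) / (2 * π * N) : ℝ) : ℂ))) := by
  have hcoe : ∀ t : ℝ, (periodic_exactChirpFun N lam).lift (t : UnitAddCircle) =
      Complex.exp (-(2 * π * I * lam * ((tri (2 * π * N * t) / (2 * π * N) : ℝ) : ℂ))) :=
    fun t => (periodic_exactChirpFun N lam).lift_coe t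
  refine ⟨?_, hcoe⟩
  have hf : Continuous fun t : ℝ => Complex.exp (-(2 * π * I * lam * ((tri (2 * π * N * t) / (2 * π * N) : ℝ) : ℂ))) := by
    refine Complex.continuous_exp.comp (Continuous.neg (continuous_const.mul (Complex.continuous_ofReal.comp ?_)))
    exact (continuous_tri.comp (continuous_const.mul continuous_id)).div_const _
  have h : (periodic_exactChirpFun N lam).lift ∘ (QuotientAddGroup.mk : ℝ → UnitAddCircle) =
      fun t : ℝ => Complex.exp (-(2 * π * I * lam * ((tri (2 * π * N * t) / (2 * π * N) : ℝ) : ℂ))) := by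
    funext t; exact hcoe t
  rw [(QuotientAddGroup.isQuotientMap_mk _).continuous_iff]
  change Continuous ((periodic_exactChirpFun N lam).lift ∘ (QuotientAddGroup.mk : ℝ → UnitAddCircle))
  rw [h]
  exact hf


/-- Circle Fourier coefficients of a difference of continuous functions. [cite: Grafakos2014, Prop. 3.1.2 (5)] -/
theorem fourierCoeff_sub_of_continuous {g h : UnitAddCircle → ℂ} (hg : Continuous g) (hh : Continuous h) (m : ℤ) :
    fourierCoeff (fun b => g b - h b) m = fourierCoeff g m - fourierCoeff h m := by
  have hgh : Continuous fun b => g b - h b := hg.sub hh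
  have h1 := fourierCoeff_add_of_continuous (G := fun b => g b - h b) hgh hh m
  have h2 : (fun b => (g b - h b) + h b) = g := by funext b; ring
  rw [h2] at h1
  rw [h1]; ring

/-! ## §3 The V half-step window inequality -/

/-- **THE V HALF-STEP WINDOW INEQUALITY** (see the file header for the shape and the meaning of the data).  Integer strain
`γ = G`; `a = b ∘ shearMap 1 0 (γU_j)`; fibres `n = k₁`, window variable `k₀`; `T_χ b = Σ_l χ(l) A⁰_l b` the input cut-off.
[cite: Grafakos2014, Prop. 3.1.2 (5) and Prop. 3.2.7 (3)] [cite: ElgindiLissMattingly2025, §1 (slope ±1 branches)] -/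
theorem sum_window_sq_norm_vstep_le (P : CascadeParams) {G : ℕ} (hγ : P.γ = G) (hδ₀ : 0 < P.δ₀) (hd : 0 < P.d)
    (hN₀ : 1 ≤ P.N₀) (hρN : 1 ≤ P.ρN) (j : ℕ)
    {b : UnitAddTorus (Fin 2) → ℂ} (hb : Continuous b) (hbs : Summable fun k => ‖mFourierCoeff b k‖) (hb1 : ∀ x, ‖b x‖ ≤ 1)
    (W : Finset (Fin 2 → ℤ)) (χ : ℤ → ℂ) (Sχ : Finset ℤ) (hχS : ∀ l, l ∉ Sχ → χ l = 0) (hχ1 : ∀ l, ‖χ l‖ ≤ 1) (L : ℕ)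
    (hχL : ∀ l, χ l ≠ 0 → |l| < L) (ψ : ℤ → ℤ → ℂ) (Sψ : ℤ → Finset ℤ) (hψS : ∀ n m, m ∉ Sψ n → ψ n m = 0)
    (hψ0 : ∀ k ∈ W, ψ (k 1) (k 1 * G) = 0 ∧ ψ (k 1) (-(k 1 * G)) = 0)
    (hψ1 : ∀ k ∈ W, ∀ l : ℤ, |l| < L → ψ (k 1) (k 0 - l) = 1)
    {w M ε A : ℝ} (hw : 0 < w) (hM : 1 ≤ M) (hMδ : M * P.δ j < π / 2) (hMw : M * P.δ j < 2 * π * P.N j * w) (hA0 : 0 ≤ A)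
    (hA : ∀ k ∈ W, (∫ s : UnitAddCircle, ‖∑ m ∈ Sψ (k 1), ψ (k 1) m * fourier (-m) s‖) + 2 ≤ A) (hε0 : 0 ≤ ε)
    (hε : ∀ k ∈ W, 2 * (2 * ∫ s in {s : UnitAddCircle | w / 2 ≤ ‖s‖}, ‖∑ m ∈ Sψ (k 1), ψ (k 1) m * fourier (-m) s‖) +
      2 * π * |((k 1 * G : ℤ) : ℝ)| * (Real.exp (-(M ^ 2 / 2)) / (2 * P.N j)) ≤ ε) :
    ∑ k ∈ W, ‖mFourierCoeff (b ∘ shearMap 1 0 (amp ⟨P.U j, P.U_periodic j, P.contDiff_U (P.δ_pos hδ₀ hd j)⟩ P.γ)) k‖ ^ 2 ≤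
      ((∫ s : UnitAddCircle, ‖∑ l ∈ Sχ, χ l * fourier (-l) s‖) *
          Real.sqrt (ε ^ 2 + (ε + 2 * A) ^ 2 * (2 * P.N j * (2 * (2 * w)))) +
        Real.sqrt (∑ n ∈ W.image (fun k => k 1), ∫ x : UnitAddTorus (Fin 2),
          ‖∫ s : UnitAddCircle, (fourier (-n) s : ℂ) •
            (b (x + Pi.single (1 : Fin 2) s) - ∑ l ∈ Sχ, χ l * ∫ s' : UnitAddCircle,
              (fourier (-l) s' : ℂ) • b (x + Pi.single (1 : Fin 2) s + Pi.single (0 : Fin 2) s'))‖ ^ 2)) ^ 2 := by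
  classical
  have h10 : (1 : Fin 2) ≠ 0 := by decide
  have hπ : 0 < π := Real.pi_pos
  have hN : P.N j ≠ 0 := (N_pos P hN₀ hρN j).ne'
  have hNpos : 0 < P.N j := Nat.pos_of_ne_zero hN
  have hNr : (0 : ℝ) < P.N j := by exact_mod_cast hNpos
  have hc : 0 < 2 * π * (P.N j : ℝ) := by positivity
  set Ψ : ShearProfile := amp ⟨P.U j, P.U_periodic j, P.contDiff_U (P.δ_pos hδ₀ hd j)⟩ P.γ with hΨ
  have hΨt : ∀ t : ℝ, Ψ t = P.γ * P.U j t := fun t => amp_apply _ _ _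
  -- the input cut-off and its complement
  set T : UnitAddTorus (Fin 2) → ℂ := fun x => ∑ l ∈ Sχ, χ l *
    ∫ s : UnitAddCircle, (fourier (-l) s : ℂ) • b (x + Pi.single (0 : Fin 2) s) with hT
  have hTc : Continuous T := continuous_finsetSum _ fun l _ => continuous_const.mul (continuous_twistedAxisAvg hb 0 l)
  have hTcoef : ∀ k, mFourierCoeff T k = χ (k 0) * mFourierCoeff b k := fun k => mFourierCoeff_axisCutoff hb 0 hχS k
  have hTs : Summable fun k => ‖mFourierCoeff T k‖ := by
    refine Summable.of_nonneg_of_le (fun k => norm_nonneg _) (fun k => ?_) hbs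
    rw [hTcoef k, norm_mul]
    exact mul_le_of_le_one_left (norm_nonneg _) (hχ1 _)
  set θ₂ : UnitAddTorus (Fin 2) → ℂ := fun x => b x - T x with hθ₂
  have hθ₂c : Continuous θ₂ := hb.sub hTc
  have hsum : (fun x => T x + θ₂ x) = b := by funext x; simp [hθ₂]
  -- the exact chirps, the circle kernels, the chirp split
  set g0 : ℤ → UnitAddCircle → ℂ := fun n => (periodic_exactChirpFun (P.N j) (n * G)).lift with hg0
  have hg0c : ∀ n, Continuous (g0 n) := fun n => (continuous_exactChirp_lift (P.N j) (n * G)).1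
  have hg0t : ∀ n (t : ℝ), g0 n (t : UnitAddCircle) =
      Complex.exp (-(2 * π * I * ((n * G : ℤ)) * ((tri (2 * π * P.N j * t) / (2 * π * P.N j) : ℝ) : ℂ))) :=
    fun n t => (continuous_exactChirp_lift (P.N j) (n * G)).2 t
  have hg01 : ∀ n bb, ‖g0 n bb‖ ≤ 1 := by
    intro n bb
    obtain ⟨t, rfl⟩ := QuotientAddGroup.mk_surjective bb
    rw [hg0t]; exact norm_exp_chirp_le _ _
  set kψ : ℤ → UnitAddCircle → ℂ := fun n s => ∑ m ∈ Sψ n, ψ n m * fourier (-m) s with hkψ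
  have hkψc : ∀ n, Continuous (kψ n) := fun n =>
    continuous_finsetSum _ fun m _ => continuous_const.mul (fourier (-m)).continuous
  set gmid : ℤ → UnitAddCircle → ℂ := fun n bb => (∫ s : UnitAddCircle, kψ n s * g0 n (bb + s)) + (twist Ψ n bb - g0 n bb)
    with hgmid
  set grest : ℤ → UnitAddCircle → ℂ := fun n bb => g0 n bb - ∫ s : UnitAddCircle, kψ n s * g0 n (bb + s) with hgrest
  have hgmidc : ∀ n, Continuous (gmid n) := fun n =>
    (continuous_circleCutoff (hkψc n) (hg0c n)).add ((continuous_twist Ψ n).sub (hg0c n))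
  have hgrestc : ∀ n, Continuous (grest n) := fun n => (hg0c n).sub (continuous_circleCutoff (hkψc n) (hg0c n))
  have hsplit : ∀ k ∈ W, ∀ bb, twist Ψ (k 1) bb = gmid (k 1) bb + grest (k 1) bb := by
    intro k _ bb; simp only [hgmid, hgrest]; ring
  -- exact separation
  have hsep : ∀ k ∈ W, ∀ m : ℤ, fourierCoeff (grest (k 1)) m * mFourierCoeff T (k - Pi.single 0 m) = 0 := by
    intro k hk m
    rw [hTcoef]
    have e0 : (k - Pi.single (0 : Fin 2) m : Fin 2 → ℤ) 0 = k 0 - m := by simp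
    rw [e0]
    by_cases hχ0 : χ (k 0 - m) = 0
    · rw [hχ0, zero_mul, mul_zero]
    · have hl : |k 0 - m| < L := hχL _ hχ0
      have hψm : ψ (k 1) m = 1 := by
        have := hψ1 k hk (k 0 - m) hl
        rwa [show k 0 - (k 0 - m) = m by ring] at this
      have hcoef : fourierCoeff (grest (k 1)) m = 0 := by
        simp only [hgrest]
        rw [fourierCoeff_sub_of_continuous (hg0c _) (continuous_circleCutoff (hkψc _) (hg0c _)),
          show (fun y : UnitAddCircle => ∫ s : UnitAddCircle, kψ (k 1) s * g0 (k 1) (y + s)) =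
            (fun y : UnitAddCircle => ∫ s : UnitAddCircle, (∑ m' ∈ Sψ (k 1), ψ (k 1) m' * fourier (-m') s) * g0 (k 1) (y + s))
            from rfl,
          fourierCoeff_circleCutoff (hg0c _) (hψS (k 1)) m, hψm, one_mul, sub_self]
      rw [hcoef, zero_mul]
  -- the corner set, the majorant
  set C : Set UnitAddCircle := (((Finset.Ico (0 : ℤ) (2 * P.N j)).image
      fun l : ℤ => (((2 * (l : ℝ) + 1) / (4 * P.N j) : ℝ) : UnitAddCircle)) : Set UnitAddCircle) with hC
  set ρ : UnitAddCircle → ℝ := fun bb => ε + 2 * A * max 0 (1 - infDist bb C / (2 * w)) with hρ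
  have hρc : Continuous ρ := continuous_const.add (continuous_const.mul (continuous_tent C (2 * w)))
  have hρ0 : ∀ bb, 0 ≤ ρ bb := fun bb => by
    have := (tent_nonneg_le_one C (by positivity : 0 < 2 * w) bb).1
    simp only [hρ]; positivity
  have hbd : ∀ k ∈ W, ∀ bb, ‖gmid (k 1) bb‖ ≤ ρ bb := by
    intro k hk bb
    have hkA := hA k hk
    have hkε := hε k hk
    have hkψ1 : (∫ s : UnitAddCircle, ‖kψ (k 1) s‖) + 2 ≤ A := by simpa only [hkψ] using hkA
    by_cases hnear : infDist bb C < w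
    · -- on the layer: the crude bound `A`
      have h1 : ‖∫ s : UnitAddCircle, kψ (k 1) s * g0 (k 1) (bb + s)‖ ≤ (∫ s : UnitAddCircle, ‖kψ (k 1) s‖) * 1 :=
        norm_circleCutoff_le (hkψc _) (hg0c _) (hg01 _) bb
      have h2 : ‖twist Ψ (k 1) bb - g0 (k 1) bb‖ ≤ 2 := by
        refine (norm_sub_le _ _).trans ?_
        have := hg01 (k 1) bb
        rw [norm_twist]; linarith
      have h3 : ‖gmid (k 1) bb‖ ≤ A := by
        simp only [hgmid]
        refine (norm_add_le _ _).trans ?_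
        linarith
      have h4 := half_le_tent_of_infDist_lt C hw hnear
      have : A ≤ ρ bb := by
        simp only [hρ]
        nlinarith
      exact h3.trans this
    · -- off the layer: orthogonality + kernel tail, and the rounding remainder
      push Not at hnear
      obtain ⟨t, rfl⟩ := QuotientAddGroup.mk_surjective bb
      have hfar := phase_far_of_le_infDist hNpos hnear
      have hfar1 : ∀ m : ℤ, π * P.N j * w < |2 * π * P.N j * t - (π / 2 + π * m)| := fun m =>
        lt_of_lt_of_le (by nlinarith [mul_pos (mul_pos hπ hNr) hw]) (hfar m)
      have hfar2 : ∀ m : ℤ, M * P.δ j < |2 * π * P.N j * t - (π / 2 + π * m)| := fun m =>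
        lt_of_lt_of_le hMw (hfar m)
      -- mid-band part of the exact chirp
      have h1 := norm_circleCutoff_exactChirp_le hNpos (hg0c (k 1)) (hg0t (k 1)) (Sψ (k 1)) (hψ0 k hk).1 (hψ0 k hk).2 hfar1
      have hr : π * ↑(P.N j) * w / (2 * π * ↑(P.N j)) = w / 2 := by field_simp
      rw [hr] at h1
      have h1' : ‖∫ s : UnitAddCircle, kψ (k 1) s * g0 (k 1) ((t : UnitAddCircle) + s)‖ ≤
          2 * ∫ s in {s : UnitAddCircle | w / 2 ≤ ‖s‖}, ‖kψ (k 1) s‖ := by simpa only [hkψ] using h1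
      have hkε' : 2 * (2 * ∫ s in {s : UnitAddCircle | w / 2 ≤ ‖s‖}, ‖kψ (k 1) s‖) +
          2 * π * |((k 1 * G : ℤ) : ℝ)| * (Real.exp (-(M ^ 2 / 2)) / (2 * P.N j)) ≤ ε := by simpa only [hkψ] using hkε
      -- rounding remainder
      have hU := abs_U_sub_tri_le_of_far P hδ₀ hd hN₀ hρN hM hMδ hfar2
      have h2 : ‖twist Ψ (k 1) ((t : ℝ) : UnitAddCircle) - g0 (k 1) (t : UnitAddCircle)‖ ≤
          2 * π * |((k 1 * G : ℤ) : ℝ)| * (Real.exp (-(M ^ 2 / 2)) / (2 * P.N j)) := by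
        rw [twist_coe, hΨt, hγ, hg0t]
        have e1 : -(2 * ↑π * I * ((k 1 : ℤ) : ℂ) * (((G : ℝ) * P.U j t : ℝ) : ℂ)) =
            -(2 * π * I * (((k 1 * G : ℤ) : ℝ) : ℂ) * ((P.U j t : ℝ) : ℂ)) := by push_cast; ring
        have e2 : -(2 * ↑π * I * ((k 1 * G : ℤ) : ℂ) * ((tri (2 * π * P.N j * t) / (2 * π * P.N j) : ℝ) : ℂ)) =
            -(2 * π * I * (((k 1 * G : ℤ) : ℝ) : ℂ) * ((tri (2 * π * P.N j * t) / (2 * π * P.N j) : ℝ) : ℂ)) := by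
          push_cast; ring
        rw [e1, e2]
        refine (norm_exp_chirp_sub_le _ _ _).trans ?_
        exact mul_le_mul_of_nonneg_left hU (by positivity)
      have hT0 : 0 ≤ ∫ s in {s : UnitAddCircle | w / 2 ≤ ‖s‖}, ‖kψ (k 1) s‖ := integral_nonneg fun _ => norm_nonneg _
      have h3 : ‖gmid (k 1) (t : UnitAddCircle)‖ ≤ ε := by
        simp only [hgmid]
        refine (norm_add_le _ _).trans ?_
        linarith [h1', h2, hkε', hT0]
      have : ε ≤ ρ (t : UnitAddCircle) := by
        have := (tent_nonneg_le_one C (by positivity : 0 < 2 * w) (t : UnitAddCircle)).1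
        simp only [hρ]; nlinarith
      exact h3.trans this
  -- the window lemma
  have hmain := sum_window_sq_norm_comp_shearMap_le_fibre hTc hTs hθ₂c h10 Ψ W gmid grest hgmidc hgrestc hsplit hsep hρc hρ0 hbd
  rw [hsum] at hmain
  refine hmain.trans (pow_le_pow_left₀ (by positivity) (add_le_add ?_ le_rfl) 2)
  -- the zone term: sup norm × kernel `L¹` norm × layer mass
  have hZ : ∫ x : UnitAddTorus (Fin 2), ρ (x 0) ^ 2 * ‖T x‖ ^ 2 ≤
      (∫ s : UnitAddCircle, ‖∑ l ∈ Sχ, χ l * fourier (-l) s‖) ^ 2 * 1 ^ 2 * ∫ bb : UnitAddCircle, ρ bb ^ 2 :=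
    integral_weight_mul_norm_axisCutoff_sq_le hb hb1 0 χ Sχ hρc
  have hρ2 : ∫ bb : UnitAddCircle, ρ bb ^ 2 ≤ ε ^ 2 + (ε + 2 * A) ^ 2 * (2 * P.N j * (2 * (2 * w))) :=
    integral_majorant_sq_le hNpos (by positivity : 0 < 2 * w) hε0 (by positivity : 0 ≤ 2 * A)
  have hK0 : 0 ≤ ∫ s : UnitAddCircle, ‖∑ l ∈ Sχ, χ l * fourier (-l) s‖ := integral_nonneg fun s => norm_nonneg _
  calc Real.sqrt (∫ x : UnitAddTorus (Fin 2), ρ (x 0) ^ 2 * ‖T x‖ ^ 2)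
      ≤ Real.sqrt ((∫ s : UnitAddCircle, ‖∑ l ∈ Sχ, χ l * fourier (-l) s‖) ^ 2 *
          (ε ^ 2 + (ε + 2 * A) ^ 2 * (2 * P.N j * (2 * (2 * w))))) := by
        refine Real.sqrt_le_sqrt (hZ.trans ?_)
        rw [one_pow, mul_one]
        exact mul_le_mul_of_nonneg_left hρ2 (sq_nonneg _)
    _ = (∫ s : UnitAddCircle, ‖∑ l ∈ Sχ, χ l * fourier (-l) s‖) *
          Real.sqrt (ε ^ 2 + (ε + 2 * A) ^ 2 * (2 * P.N j * (2 * (2 * w)))) := by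
        rw [Real.sqrt_mul (sq_nonneg _), Real.sqrt_sq hK0]

end Summit.AnomalousDissipation.AnomalousDissipation.Theorems.SawtoothPulseCascade.K1Window
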